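import Mathlib
import Summits.Schanuel.Schanuel.Theses.RigidCore
import Summits.Schanuel.Schanuel.Theorems.AclSubsetLogFreeCore.Negative.ExpAclField
import Literature.NumberTheory.Transcendental.LindemannWeierstrassProofs
import Literature.NumberTheory.Transcendental.OneMotiveToricProofs

/-!
# Crux `MinimalCounterexampleInAcl` (stmt-Schanuel-0969), line `kernel-arithmetic-selection` —
# the hypothesis `trdeg ℚ(x, eˣ) < n` is load-bearing in the stubs `stub_endgame`,
# `stub_expImageFinite_offLog` and `stub_mateFirstFailure`

Negative (load-bearing) lemmas for the lead's registered stub set (skeleton sha `f7f45f09face`),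
all sorry-free.  Each takes a registered stub signature VERBATIM, deletes the single conjunct
`Algebra.trdeg ℚ ℚ(x, eˣ) < n` from the first-failure bundle (linear independence and
`∀ r < n, SchanuelRank r` are kept) and refutes the result with an explicit tuple:

* `endgame_false_without_trdeg` — `n = 1`, `x = (2πi)` (defect 0, Lindemann): the fibre of the
  ℚ-locus `W = {Y = 1}` over `y = 1` is all of `ℂ`, so the "rational affine subspace inside the
  fibre" hypothesis of `stub_endgame` holds with `m = 0` and no contradiction follows.  Any proof of
  `stub_endgame` must spend `dim W = trdeg < n`.
* `expImageFiniteOffLog_false_without_trdeg` — `n = 1`, `x = (π)` (Nesterenko, tree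
  `algebraicIndependent_pi_exp_pi`): the ℚ-locus is all of `ℂ × ℂ`, every non-zero `c` is a mate,
  the off-log hypothesis holds (`e^π` transcendental) and the exponential image of the mate set is
  infinite.  Any proof of `stub_expImageFinite_offLog` must spend `trdeg < n`.
* `mateLocusEq_false_without_trdeg` — `n = 1`, `x = (π)`, `x' = (1)`: `x'` is a mate of `x` but the
  pulled-back loci differ (`0 ∈ locusPts x = ℂ`, `0 ∉ locusPts x'` via `X − 1`).  The locus-equality
  half of `stub_mateFirstFailure` needs `trdeg < n` (through `trdeg = n − 1` on both sides).

(The kept hypothesis `∀ r < 1, SchanuelRank r` is the theorem `schanuelRank_zero`; linear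
independence of a non-zero `1`-tuple is automatic; `2πi` transcendental is the tree's
`transcendental_two_pi_I`.)
-/

noncomputable section

set_option linter.dupNamespace false

open Complex Set
open Literature.NumberTheory.Transcendental (SchanuelRank schanuelRank_zero transcendental_two_pi_I)
open Summit.Schanuel.Schanuel.Theorems.AclSubsetLogFreeCore.Negative (algebraicIndependent_pi_exp_pi)

namespace Summit.Schanuel.Schanuel.Theorems.MinimalCounterexampleInAcl.Negative

/-! ## Small shared facts -/

/-- Below rank `1` Schanuel is the trivial `SchanuelRank 0`. -/
theorem schanuelRank_of_lt_one : ∀ r < 1, SchanuelRank r := by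
  intro r hr
  interval_cases r
  exact schanuelRank_zero

/-- A non-zero constant `1`-tuple is ℚ-linearly independent. -/
theorem linearIndependent_const_fin_one {c : ℂ} (hc : c ≠ 0) :
    LinearIndependent ℚ (fun _ : Fin 1 => c) :=
  (linearIndependent_unique_iff (v := fun _ : Fin 1 => c)).2 hc

/-! ## `stub_endgame` without `trdeg < n`: false at `x = (2πi)`, `m = 0` -/

/-- On the fibre over `y = e^{2πi} = 1`, evaluation factors through the substitution `Y ↦ 1`
(`MvPolynomial.aeval (Sum.elim (fun _ => Polynomial.X) (fun _ => 1))`, landing in `ℚ[X]`). -/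
theorem aeval_fibre_twoPiI (z : Fin 1 → ℂ) (p : MvPolynomial (Fin 1 ⊕ Fin 1) ℚ) :
    MvPolynomial.aeval (Sum.elim z (Complex.exp ∘ fun _ : Fin 1 => (2 * Real.pi * I : ℂ))) p =
      Polynomial.aeval (z 0)
        (MvPolynomial.aeval (Sum.elim (fun _ : Fin 1 => (Polynomial.X : Polynomial ℚ))
          (fun _ : Fin 1 => (1 : Polynomial ℚ))) p) := by
  have key : (MvPolynomial.aeval (Sum.elim z (Complex.exp ∘ fun _ : Fin 1 => (2 * Real.pi * I : ℂ))) :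
      MvPolynomial (Fin 1 ⊕ Fin 1) ℚ →ₐ[ℚ] ℂ) =
      (Polynomial.aeval (z 0)).comp
        (MvPolynomial.aeval (Sum.elim (fun _ : Fin 1 => (Polynomial.X : Polynomial ℚ))
          (fun _ : Fin 1 => (1 : Polynomial ℚ)))) := by
    refine MvPolynomial.algHom_ext fun i => ?_
    rcases i with i | i
    · obtain rfl : i = 0 := Subsingleton.elim i 0
      simp
    · simp
  exact congrArg (fun f : MvPolynomial (Fin 1 ⊕ Fin 1) ℚ →ₐ[ℚ] ℂ => f p) key

/-- **`trdeg < n` is load-bearing in `stub_endgame`.**  The registered signature of `stub_endgame`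
with the conjunct `Algebra.trdeg ℚ ℚ(x, eˣ) < n` deleted is FALSE: at `n = 1`, `x = (2πi)` (ℚ-linearly
independent, `SchanuelRank 0` trivial), `m = 0`, `q = ()` the whole fibre `ℂ × {1}` lies on the
ℚ-locus `{Y = 1}` of `(2πi, 1)` (`2πi` is transcendental, tree `transcendental_two_pi_I`), so the
subspace hypothesis holds and nothing is contradictory. -/
theorem endgame_false_without_trdeg :
    ¬ ∀ (n : ℕ) (x : Fin n → ℂ), (LinearIndependent ℚ x ∧
        ∀ r < n, Literature.NumberTheory.Transcendental.SchanuelRank r) →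
      ∀ (m : ℕ), m < n → ∀ (q : Fin m → Fin n → ℚ), LinearIndependent ℚ q →
        (∀ z : Fin n → ℂ, (∀ j, ∑ i, (q j i : ℂ) * z i = ∑ i, (q j i : ℂ) * x i) →
          ∀ p : MvPolynomial (Fin n ⊕ Fin n) ℚ,
            MvPolynomial.aeval (Sum.elim x (Complex.exp ∘ x)) p = 0 →
            MvPolynomial.aeval (Sum.elim z (Complex.exp ∘ x)) p = 0) → False := by
  intro h
  refine h 1 (fun _ => 2 * Real.pi * I) ⟨linearIndependent_const_fin_one two_pi_I_ne_zero,
    schanuelRank_of_lt_one⟩ 0 one_pos (fun j => Fin.elim0 j) linearIndependent_empty_type ?_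
  intro z _ p hp
  rw [aeval_fibre_twoPiI] at hp ⊢
  set r : Polynomial ℚ := MvPolynomial.aeval (Sum.elim (fun _ : Fin 1 => (Polynomial.X : Polynomial ℚ))
    (fun _ : Fin 1 => (1 : Polynomial ℚ))) p with hr
  have hp0 : r = 0 := by
    by_contra hne
    exact transcendental_two_pi_I ⟨r, hne, by simpa using hp⟩
  rw [hp0, map_zero]

/-! ## `stub_expImageFinite_offLog` without `trdeg < n`: false at `x = (π)` -/

/-- `(π, e^π)` indexed by `Fin 1 ⊕ Fin 1` is algebraically independent (Nesterenko). -/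
theorem algebraicIndependent_piTuple :
    AlgebraicIndependent ℚ (Sum.elim (fun _ : Fin 1 => (Real.pi : ℂ))
      (Complex.exp ∘ fun _ : Fin 1 => (Real.pi : ℂ))) := by
  have h := algebraicIndependent_pi_exp_pi.comp
    (Sum.elim (fun _ : Fin 1 => (0 : Fin 2)) (fun _ : Fin 1 => (1 : Fin 2)))
    (by
      rintro (a | a) (b | b) hab
      · rw [Subsingleton.elim a b]
      · simp at hab
      · simp at hab
      · rw [Subsingleton.elim a b])
  convert h using 1
  ext (i | i) <;> simp

/-- The ℚ-locus of `(π, e^π)` is everything: only the zero polynomial vanishes there. -/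
theorem eq_zero_of_aeval_piTuple {p : MvPolynomial (Fin 1 ⊕ Fin 1) ℚ}
    (hp : MvPolynomial.aeval (Sum.elim (fun _ : Fin 1 => (Real.pi : ℂ))
      (Complex.exp ∘ fun _ : Fin 1 => (Real.pi : ℂ))) p = 0) : p = 0 :=
  algebraicIndependent_piTuple (by simpa using hp)

/-- **`trdeg < n` is load-bearing in `stub_expImageFinite_offLog`.**  The registered signature with
the conjunct `Algebra.trdeg ℚ ℚ(x, eˣ) < n` deleted is FALSE: at `n = 1`, `x = (π)` (ℚ-linearly
independent, `SchanuelRank 0` trivial, `e^π` transcendental — Nesterenko) the ℚ-locus of `(π, e^π)`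
is all of `ℂ²`, every non-zero `c` is a ℚ-linearly independent mate, and the exponential image of
the mate set contains the infinitely many `e^{k+1}`, `k ∈ ℕ`. -/
theorem expImageFiniteOffLog_false_without_trdeg :
    ¬ ∀ (n : ℕ) (x : Fin n → ℂ), (LinearIndependent ℚ x ∧
        ∀ r < n, Literature.NumberTheory.Transcendental.SchanuelRank r) →
      (∃ i, Transcendental ℚ (Complex.exp (x i))) →
        ((fun x' : Fin n → ℂ => Complex.exp ∘ x') '' {x' : Fin n → ℂ | LinearIndependent ℚ x' ∧
          ∀ p : MvPolynomial (Fin n ⊕ Fin n) ℚ,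
            MvPolynomial.aeval (Sum.elim x (Complex.exp ∘ x)) p = 0 →
            MvPolynomial.aeval (Sum.elim x' (Complex.exp ∘ x')) p = 0}).Finite := by
  intro h
  have hpi0 : (Real.pi : ℂ) ≠ 0 := by exact_mod_cast Real.pi_ne_zero
  have htr : Transcendental ℚ (Complex.exp (Real.pi : ℂ)) := by
    have := algebraicIndependent_pi_exp_pi.transcendental 1
    simpa using this
  have hfin := h 1 (fun _ => (Real.pi : ℂ)) ⟨linearIndependent_const_fin_one hpi0,
    schanuelRank_of_lt_one⟩ ⟨0, htr⟩
  -- the injective family `k ↦ (e^{k+1})` inside the image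
  let f : ℕ → (Fin 1 → ℂ) := fun k _ => Complex.exp ((k : ℂ) + 1)
  have hf : Function.Injective f := by
    intro a b hab
    have h1 : Complex.exp ((a : ℂ) + 1) = Complex.exp ((b : ℂ) + 1) := congr_fun hab 0
    have h2 : Real.exp ((a : ℝ) + 1) = Real.exp ((b : ℝ) + 1) := by
      apply Complex.ofReal_injective
      simpa [Complex.ofReal_exp] using h1
    have h3 := Real.exp_injective h2
    exact_mod_cast (add_right_cancel h3 : (a : ℝ) = b)
  refine (Set.infinite_range_of_injective hf).mono ?_ |>.not_finite <| hfin
  rintro _ ⟨k, rfl⟩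
  refine ⟨fun _ => (k : ℂ) + 1, ⟨linearIndependent_const_fin_one ?_, fun p hp => ?_⟩, rfl⟩
  · exact_mod_cast Nat.succ_ne_zero k
  · rw [eq_zero_of_aeval_piTuple hp, map_zero]

/-! ## The locus-equality half of `stub_mateFirstFailure` without `trdeg < n`: false at `x = (π)`, `x' = (1)` -/

/-- **`trdeg < n` is load-bearing in `stub_mateFirstFailure` (locus equality).**  With the conjunct
`Algebra.trdeg ℚ ℚ(x, eˣ) < n` deleted from hypothesis and conclusion, the remaining claim "a mate of
`x` has the same pulled-back ℚ-locus" is FALSE: `n = 1`, `x = (π)`, `x' = (1)` — `x'` is a mate of `x`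
(the locus of `(π, e^π)` is everything, Nesterenko), but `0 ∈ locusPts x` while `0 ∉ locusPts x'`
(the relation `X − 1` of `(1, e)` fails at `(0, 1)`). -/
theorem mateLocusEq_false_without_trdeg :
    ¬ ∀ (n : ℕ) (x x' : Fin n → ℂ), (LinearIndependent ℚ x ∧
        ∀ r < n, Literature.NumberTheory.Transcendental.SchanuelRank r) →
      (LinearIndependent ℚ x' ∧ ∀ p : MvPolynomial (Fin n ⊕ Fin n) ℚ,
        MvPolynomial.aeval (Sum.elim x (Complex.exp ∘ x)) p = 0 →
        MvPolynomial.aeval (Sum.elim x' (Complex.exp ∘ x')) p = 0) →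
      {x'' : Fin n → ℂ | ∀ p : MvPolynomial (Fin n ⊕ Fin n) ℚ,
          MvPolynomial.aeval (Sum.elim x' (Complex.exp ∘ x')) p = 0 →
          MvPolynomial.aeval (Sum.elim x'' (Complex.exp ∘ x'')) p = 0} =
        {x'' : Fin n → ℂ | ∀ p : MvPolynomial (Fin n ⊕ Fin n) ℚ,
          MvPolynomial.aeval (Sum.elim x (Complex.exp ∘ x)) p = 0 →
          MvPolynomial.aeval (Sum.elim x'' (Complex.exp ∘ x'')) p = 0} := by
  intro h
  have hpi0 : (Real.pi : ℂ) ≠ 0 := by exact_mod_cast Real.pi_ne_zero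
  have hEq := h 1 (fun _ => (Real.pi : ℂ)) (fun _ => (1 : ℂ))
    ⟨linearIndependent_const_fin_one hpi0, schanuelRank_of_lt_one⟩
    ⟨linearIndependent_const_fin_one one_ne_zero, fun p hp => by
      rw [eq_zero_of_aeval_piTuple hp, map_zero]⟩
  -- `0 ∈ locusPts (π)` but `0 ∉ locusPts (1)`
  have h0 : (fun _ : Fin 1 => (0 : ℂ)) ∈ {x'' : Fin 1 → ℂ | ∀ p : MvPolynomial (Fin 1 ⊕ Fin 1) ℚ,
      MvPolynomial.aeval (Sum.elim (fun _ : Fin 1 => (Real.pi : ℂ))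
        (Complex.exp ∘ fun _ : Fin 1 => (Real.pi : ℂ))) p = 0 →
      MvPolynomial.aeval (Sum.elim x'' (Complex.exp ∘ x'')) p = 0} :=
    fun p hp => by rw [eq_zero_of_aeval_piTuple hp, map_zero]
  rw [← hEq] at h0
  have h1 := h0 (MvPolynomial.X (Sum.inl 0) - 1) (by simp)
  simp at h1

end Summit.Schanuel.Schanuel.Theorems.MinimalCounterexampleInAcl.Negative

end
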